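import Mathlib
import Summits.MatrixMultiplication.MatrixMultiplication.Theorems.SnSubsetDichotomyHyperoctahedralThresholdStubSameColourSupply

/-!
# POOR prepays self-cleanness of darts (crux `HyperoctahedralThreshold`, open core `stub_poorRigidCore`; siege k9)

Conventions of `…StubSameColourSupply` / `…SupplyAvoiding`: three involutions `μ b` of `Fin n` act on the right,
`x · g := g.foldl (fun v b => μ b v) x`; a DART of colour `c` and length `k` is `(a, g)` with `g` reduced of length `k` and
first letter `≠ c`; its rungs are `r_t = (a · g_[t], (μ c a) · g_[t])`, `t ≤ k` (`g_[t] = g.take t`).  A dart is SELF-CLEAN when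
any two of its rungs are equal, swapped-equal, or disjoint (the "clean" format of the core's conclusion).

Two bricks of the dart-level bookkeeping for the with-`R` core (memo `memo-k9-dart-bookkeeping.md`, evidence on
stmt-MatrixMultiplication-10883):

* `poor_uniform` — the core's POOR hypothesis (stated, as in `stub_poorRigidCore`, for CYCLICALLY reduced words with the real
  length bound `|z| ≤ n^{1/4}`) bounds the fixed points of EVERY nonempty reduced word `t` of length `≤ L ≤ n^{1/4}` by
  `Φ_L := (4L²)^(⌊log₂ L⌋+1) · (|R| + 1)`: strip equal end letters (`Fix (d m d) ≅ Fix m` via `x ↦ μ d x`), a single letter has no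
  fixed point, and a reduced word with distinct end letters is cyclically reduced (`card_fix_reduced_le`).
* `card_selfUnclean_le` — the darts that are NOT self-clean number at most `3 (k+1)² · 2^k · Φ` whenever every nonempty reduced
  word of length `≤ 2k+1` has `≤ Φ` fixed points: a non-clean rung pair `(s, t)`, `s ≠ t`, is a coincidence `a·g_[s] = a·g_[t]`
  (then `a·g_[s] ∈ Fix g_(s,t]`), or the same on the `c`-side, or `a·g_[s] = (μ c a)·g_[t]` (then `a·g_[s] ∈ Fix(g_[s]⁻¹ c g_[t])`,
  a reduced word because `first(g) ≠ c`); each family is counted fibrewise over `g` by the bijection trick (`card_pp_fibre_le`,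
  `card_pq_fibre_le`).  With `poor_uniform` this is `≤ n^{3/4+o(1)} · 2^k = o(n · 2^k)`: self-cleanness is free at dart level.

Pure finite combinatorics; no definitions; reuses `foldl_act_reverse`, `foldl_act_injective`, `mem_words`, `card_redWords` (p112303),
with the involution and threshold-monotonicity one-liners of `…StructureWalk` / `…PoorOfRigid` inlined as `have`s.
-/

set_option linter.dupNamespace false

namespace Summit.MatrixMultiplication.MatrixMultiplication.Theorems.HyperoctahedralThreshold.SelfCleanDarts

open Finset
open Summit.MatrixMultiplication.MatrixMultiplication.Theorems.HyperoctahedralThreshold.Supply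

variable {n : ℕ}

/-! ### Fixed points of reduced words -/

-- adapted from Summits/.../SnSubsetDichotomyHyperoctahedralThresholdTwinSupply.lean (`cyclic_of_closed`, siege k5)
/-- **Fixed points of reduced words reduce to cyclically reduced words.**  If every nonempty cyclically reduced word of length
`≤ L` has at most `Φ` fixed points, so does every nonempty REDUCED word `t` of length `≤ L`: `Fix (d :: m ++ [d])` injects into
`Fix m` by `x ↦ μ d x`, a single letter has no fixed point, and distinct end letters make `t` cyclically reduced.
(Strong induction on `|t| ≤ N`.) -/
theorem card_fix_reduced_le (μ : Fin 3 → Equiv.Perm (Fin n)) (hμ : ∀ b, μ b * μ b = 1) (hfix : ∀ b v, μ b v ≠ v)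
    (L Φ : ℕ) (hΦ : ∀ z : List (Fin 3), z ≠ [] → List.IsChain (· ≠ ·) (z ++ z) → z.length ≤ L →
      ((Finset.univ : Finset (Fin n)).filter (fun x => z.foldl (fun v b => μ b v) x = x)).card ≤ Φ) :
    ∀ (N : ℕ) (t : List (Fin 3)), t.length ≤ N → t ≠ [] → List.IsChain (· ≠ ·) t → t.length ≤ L →
      ((Finset.univ : Finset (Fin n)).filter (fun x => t.foldl (fun v b => μ b v) x = x)).card ≤ Φ := by
  intro N
  induction N with
  | zero =>
    intro t hN ht
    exact absurd (List.eq_nil_of_length_eq_zero (Nat.le_zero.1 hN)) ht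
  | succ N ih =>
    intro t hN ht hc hL
    obtain ⟨d, t₁, rfl⟩ := List.exists_cons_of_ne_nil ht
    rcases List.eq_nil_or_concat t₁ with h1 | ⟨m, e, h1⟩
    · subst h1
      have h0 : ((Finset.univ : Finset (Fin n)).filter (fun x => [d].foldl (fun v b => μ b v) x = x)).card = 0 := by
        rw [Finset.card_eq_zero, Finset.filter_eq_empty_iff]
        intro x _
        exact hfix d x
      exact h0 ▸ Nat.zero_le _
    · rw [List.concat_eq_append] at h1
      subst h1
      by_cases hde : d = e
      · subst hde
        have hm : m ≠ [] := by
          rintro rfl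
          simp at hc
        have hcm : List.IsChain (· ≠ ·) m := (List.isChain_cons.1 hc).2.left_of_append
        have key : ∀ r : Fin n, (d :: (m ++ [d])).foldl (fun v b => μ b v) r = r →
            m.foldl (fun v b => μ b v) (μ d r) = μ d r := by
          intro r hr
          rw [List.foldl_cons, List.foldl_append, List.foldl_cons, List.foldl_nil] at hr
          have hdd : ∀ x : Fin n, μ d (μ d x) = x := fun x => by
            have h : (μ d * μ d) x = x := by rw [hμ d]; rfl
            simpa using h
          have := congrArg (μ d) hr
          rwa [hdd] at this
        have hlen : m.length ≤ N := by
          simp only [List.length_cons, List.length_append] at hN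
          omega
        have hmL : m.length ≤ L := by
          simp only [List.length_cons, List.length_append] at hL ⊢
          omega
        refine le_trans ?_ (ih m hlen hm hcm hmL)
        refine Finset.card_le_card_of_injOn (fun x => μ d x) ?_ ?_
        · intro x hx
          rw [Finset.mem_coe, Finset.mem_filter] at hx
          rw [Finset.mem_coe, Finset.mem_filter]
          exact ⟨Finset.mem_univ _, key x hx.2⟩
        · intro x _ y _ hxy
          exact (μ d).injective hxy
      · refine hΦ _ (List.cons_ne_nil _ _) ?_ hL
        rw [List.isChain_append]
        refine ⟨hc, hc, ?_⟩
        intro x hx y hy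
        rw [← List.cons_append, List.getLast?_concat, Option.mem_def, Option.some.injEq] at hx
        rw [List.head?_cons, Option.mem_def, Option.some.injEq] at hy
        rw [← hx, ← hy]
        exact fun h => hde h.symm

/-- **POOR is uniform over reduced words.**  The core's POOR hypothesis — every nonempty cyclically reduced `z` with
`|z| ≤ n^{1/4}` has at most `(4|z|²)^(⌊log₂|z|⌋+1)·(|R|+1)` fixed points, stated through injective families exactly as in
`stub_poorRigidCore` — gives, for every `L` with `L ≤ n^{1/4}`, the bound `(4L²)^(⌊log₂ L⌋+1)·(|R|+1)` on the number of fixed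
points of EVERY nonempty reduced word of length `≤ L`. -/
theorem poor_uniform (μ : Fin 3 → Equiv.Perm (Fin n)) (hμ : ∀ i, μ i * μ i = 1 ∧ ∀ v, μ i v ≠ v) (R : Finset (Fin n))
    (hpoor : ∀ z : List (Fin 3), z ≠ [] → List.IsChain (· ≠ ·) (z ++ z) → (z.length : ℝ) ≤ (n : ℝ) ^ ((1 : ℝ) / 4) →
      ∀ (m : ℕ) (x : Fin m → Fin n), Function.Injective x → (∀ i, z.foldl (fun v c => μ c v) (x i) = x i) →
      m ≤ (4 * z.length ^ 2) ^ (Nat.log 2 z.length + 1) * (R.card + 1))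
    (L : ℕ) (hL : (L : ℝ) ≤ (n : ℝ) ^ ((1 : ℝ) / 4)) :
    ∀ t : List (Fin 3), t ≠ [] → List.IsChain (· ≠ ·) t → t.length ≤ L →
      ((Finset.univ : Finset (Fin n)).filter (fun x => t.foldl (fun v c => μ c v) x = x)).card ≤
        (4 * L ^ 2) ^ (Nat.log 2 L + 1) * (R.card + 1) := by
  intro t ht hc htL
  refine card_fix_reduced_le μ (fun b => (hμ b).1) (fun b v => (hμ b).2 v) L _ ?_ t.length t le_rfl ht hc htL
  intro z hz hzc hzL
  obtain ⟨S, hS⟩ : ∃ S : Finset (Fin n),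
      S = (Finset.univ : Finset (Fin n)).filter (fun x => z.foldl (fun v c => μ c v) x = x) := ⟨_, rfl⟩
  rw [← hS]
  have hsub : ∀ x, x ∈ S → z.foldl (fun v c => μ c v) x = x := by
    intro x hx
    rw [hS, Finset.mem_filter] at hx
    exact hx.2
  have hzreal : (z.length : ℝ) ≤ (n : ℝ) ^ ((1 : ℝ) / 4) := le_trans (by exact_mod_cast hzL) hL
  have hinj : Function.Injective (fun i : Fin S.card => ((S.equivFin.symm i : S) : Fin n)) :=
    Subtype.val_injective.comp S.equivFin.symm.injective
  have hfixed : ∀ i : Fin S.card, z.foldl (fun v c => μ c v) ((S.equivFin.symm i : S) : Fin n) =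
      ((S.equivFin.symm i : S) : Fin n) := fun i => hsub _ (S.equivFin.symm i).2
  -- monotonicity of the threshold in the length (as in `…PoorOfRigid.thresholdA_mono`, siege k17)
  have hmono : (4 * z.length ^ 2) ^ (Nat.log 2 z.length + 1) * (R.card + 1) ≤
      (4 * L ^ 2) ^ (Nat.log 2 L + 1) * (R.card + 1) := by
    apply Nat.mul_le_mul_right
    have hz1 : 1 ≤ z.length := List.length_pos_of_ne_nil hz
    calc (4 * z.length ^ 2) ^ (Nat.log 2 z.length + 1) ≤ (4 * L ^ 2) ^ (Nat.log 2 z.length + 1) := by gcongr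
      _ ≤ (4 * L ^ 2) ^ (Nat.log 2 L + 1) :=
          Nat.pow_le_pow_right (by nlinarith) (Nat.add_le_add_right (Nat.log_mono_right hzL) 1)
  exact (hpoor z hz hzc hzreal S.card _ hinj hfixed).trans hmono

/-! ### Coincidence fibres of darts -/

/-- `p`-side (or `c`-side) coincidence fibre: for a reduced `g` of length `k` and `s < t ≤ k`, the points `b` with
`b·g_[s] = b·g_[t]` after an injective relabelling `y` number at most `Φ` — they are carried by `b ↦ (y b)·g_[s]` into the fixed
points of the nonempty reduced word `g_(s,t]`. -/
theorem card_pp_fibre_le (μ : Fin 3 → Equiv.Perm (Fin n)) (hμ : ∀ b, μ b * μ b = 1) {k s t : ℕ} (Φ : ℕ)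
    (hΦ : ∀ w : List (Fin 3), w ≠ [] → List.IsChain (· ≠ ·) w → w.length ≤ 2 * k + 1 →
      ((Finset.univ : Finset (Fin n)).filter (fun x => w.foldl (fun v b => μ b v) x = x)).card ≤ Φ)
    (g : List (Fin 3)) (hl : g.length = k) (hg : List.IsChain (· ≠ ·) g) (hst : s < t) (htk : t ≤ k)
    (y : Fin n → Fin n) (hy : Function.Injective y) :
    ((Finset.univ : Finset (Fin n)).filter
      (fun b => (g.take s).foldl (fun v b => μ b v) (y b) = (g.take t).foldl (fun v b => μ b v) (y b))).card ≤ Φ := by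
  set w := (g.take t).drop s with hw
  have hsplit : g.take t = g.take s ++ w := by
    have h := (List.take_append_drop s (g.take t)).symm
    rw [List.take_take, Nat.min_eq_left hst.le] at h
    exact h
  have hwlen : w.length = t - s := by rw [hw, List.length_drop, List.length_take]; omega
  have hwne : w ≠ [] := List.ne_nil_of_length_pos (by omega)
  have hwc : List.IsChain (· ≠ ·) w := (hg.take t).drop s
  refine le_trans ?_ (hΦ w hwne hwc (by omega))
  refine Finset.card_le_card_of_injOn (fun b => (g.take s).foldl (fun v b => μ b v) (y b)) ?_ ?_
  · intro b hb
    rw [Finset.mem_coe, Finset.mem_filter] at hb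
    rw [Finset.mem_coe, Finset.mem_filter]
    refine ⟨Finset.mem_univ _, ?_⟩
    have h := hb.2
    rw [hsplit, List.foldl_append] at h
    exact h.symm
  · intro b _ b' _ hbb'
    exact hy (foldl_act_injective μ hμ _ hbb')

/-- Cross-side coincidence fibre: for a reduced `g` of length `k` with first letter `≠ c` and `s, t ≤ k`, the points `b` with
`b·g_[s] = (μ c b)·g_[t]` number at most `Φ` — they are carried by `b ↦ b·g_[s]` into the fixed points of the reduced word
`g_[s]⁻¹ c g_[t]`. -/
theorem card_pq_fibre_le (μ : Fin 3 → Equiv.Perm (Fin n)) (hμ : ∀ b, μ b * μ b = 1) (c : Fin 3) {k s t : ℕ} (Φ : ℕ)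
    (hΦ : ∀ w : List (Fin 3), w ≠ [] → List.IsChain (· ≠ ·) w → w.length ≤ 2 * k + 1 →
      ((Finset.univ : Finset (Fin n)).filter (fun x => w.foldl (fun v b => μ b v) x = x)).card ≤ Φ)
    (g : List (Fin 3)) (hl : g.length = k) (hg : List.IsChain (· ≠ ·) g) (hh : g.head? ≠ some c)
    (hs : s ≤ k) (ht : t ≤ k) :
    ((Finset.univ : Finset (Fin n)).filter
      (fun b => (g.take s).foldl (fun v b => μ b v) b = (g.take t).foldl (fun v b => μ b v) (μ c b))).card ≤ Φ := by
  set w := (g.take s).reverse ++ c :: g.take t with hw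
  have hwne : w ≠ [] := by rw [hw]; simp
  have hhead : ∀ m x, x ∈ (g.take m).head? → x ≠ c := by
    intro m x hx hxc
    rw [List.head?_take] at hx
    split_ifs at hx with hm
    · exact Option.not_mem_none _ hx
    · subst hxc
      exact hh (Option.mem_def.1 hx)
  have hwc : List.IsChain (· ≠ ·) w := by
    rw [hw, List.isChain_append]
    refine ⟨?_, ?_, ?_⟩
    · rw [List.isChain_reverse]
      exact (hg.take _).imp (fun a b hab => Ne.symm hab)
    · refine List.isChain_cons.2 ⟨?_, hg.take _⟩
      intro x hx
      exact fun hcx => hhead t x hx hcx.symm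
    · intro x hx z hz
      rw [List.getLast?_reverse] at hx
      rw [List.head?_cons, Option.mem_def, Option.some.injEq] at hz
      rw [← hz]
      exact hhead s x hx
  have hwl : w.length ≤ 2 * k + 1 := by
    rw [hw, List.length_append, List.length_reverse, List.length_cons, List.length_take, List.length_take]
    omega
  refine le_trans ?_ (hΦ w hwne hwc hwl)
  refine Finset.card_le_card_of_injOn (fun b => (g.take s).foldl (fun v b => μ b v) b) ?_ ?_
  · intro b hb
    rw [Finset.mem_coe, Finset.mem_filter] at hb
    rw [Finset.mem_coe, Finset.mem_filter]
    refine ⟨Finset.mem_univ _, ?_⟩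
    rw [hw, List.foldl_append, foldl_act_reverse μ hμ, List.foldl_cons]
    exact hb.2.symm
  · intro b _ b' _ hbb'
    exact foldl_act_injective μ hμ _ hbb'

/-! ### Self-unclean darts are few -/

/-- **Self-cleanness is free at dart level.**  If every nonempty reduced word of length `≤ 2k+1` has at most `Φ` fixed points,
then among the `n · 2^k` darts `(a, g)` of colour `c` and length `k` at most `3 (k+1)² · 2^k · Φ` are NOT self-clean, i.e. have
two rungs `(a·g_[s], (μ c a)·g_[s])`, `(a·g_[t], (μ c a)·g_[t])` (`s, t ≤ k`) that are neither equal, nor swapped, nor disjoint.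
Stated for any decidable predicate `clean` implied by the rung condition (instantiate with the condition itself). -/
theorem card_selfUnclean_le (μ : Fin 3 → Equiv.Perm (Fin n)) (hμ : ∀ b, μ b * μ b = 1) (c : Fin 3) (k Φ : ℕ)
    (hΦ : ∀ w : List (Fin 3), w ≠ [] → List.IsChain (· ≠ ·) w → w.length ≤ 2 * k + 1 →
      ((Finset.univ : Finset (Fin n)).filter (fun x => w.foldl (fun v b => μ b v) x = x)).card ≤ Φ)
    (clean : Fin n × List (Fin 3) → Prop) [DecidablePred clean]
    (hclean : ∀ p : Fin n × List (Fin 3), (∀ s ∈ Finset.range (k + 1), ∀ t ∈ Finset.range (k + 1),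
        ((p.2.take s).foldl (fun v b => μ b v) p.1 = (p.2.take t).foldl (fun v b => μ b v) p.1 ∧
          (p.2.take s).foldl (fun v b => μ b v) (μ c p.1) = (p.2.take t).foldl (fun v b => μ b v) (μ c p.1)) ∨
        ((p.2.take s).foldl (fun v b => μ b v) p.1 = (p.2.take t).foldl (fun v b => μ b v) (μ c p.1) ∧
          (p.2.take s).foldl (fun v b => μ b v) (μ c p.1) = (p.2.take t).foldl (fun v b => μ b v) p.1) ∨
        ((p.2.take s).foldl (fun v b => μ b v) p.1 ≠ (p.2.take t).foldl (fun v b => μ b v) p.1 ∧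
          (p.2.take s).foldl (fun v b => μ b v) p.1 ≠ (p.2.take t).foldl (fun v b => μ b v) (μ c p.1) ∧
          (p.2.take s).foldl (fun v b => μ b v) (μ c p.1) ≠ (p.2.take t).foldl (fun v b => μ b v) p.1 ∧
          (p.2.take s).foldl (fun v b => μ b v) (μ c p.1) ≠ (p.2.take t).foldl (fun v b => μ b v) (μ c p.1))) →
      clean p) :
    (((Finset.univ : Finset (Fin n)) ×ˢ
        (((Finset.univ : Finset (List.Vector (Fin 3) k)).image (fun v => v.toList)).filter
          (fun g => List.IsChain (· ≠ ·) g ∧ g.head? ≠ some c))).filter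
      (fun p => ¬ clean p)).card ≤ 3 * (k + 1) ^ 2 * (2 ^ k * Φ) := by
  set W := ((Finset.univ : Finset (List.Vector (Fin 3) k)).image (fun v => v.toList)).filter
    (fun g => List.IsChain (· ≠ ·) g ∧ g.head? ≠ some c) with hWdef
  have hWcard : W.card = 2 ^ k := card_redWords k c
  set D := (Finset.univ : Finset (Fin n)) ×ˢ W with hD
  -- the three coincidence families, indexed by ordered pairs `(s, t)`
  set App : ℕ × ℕ → Finset (Fin n × List (Fin 3)) := fun st => D.filter (fun p : Fin n × List (Fin 3) =>
    st.1 ≠ st.2 ∧ (p.2.take st.1).foldl (fun v b => μ b v) p.1 = (p.2.take st.2).foldl (fun v b => μ b v) p.1) with hApp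
  set Aqq : ℕ × ℕ → Finset (Fin n × List (Fin 3)) := fun st => D.filter (fun p : Fin n × List (Fin 3) =>
    st.1 ≠ st.2 ∧ (p.2.take st.1).foldl (fun v b => μ b v) (μ c p.1) =
      (p.2.take st.2).foldl (fun v b => μ b v) (μ c p.1)) with hAqq
  set Apq : ℕ × ℕ → Finset (Fin n × List (Fin 3)) := fun st => D.filter (fun p : Fin n × List (Fin 3) =>
    (p.2.take st.1).foldl (fun v b => μ b v) p.1 = (p.2.take st.2).foldl (fun v b => μ b v) (μ c p.1)) with hApq
  -- fibrewise bound for a family cut out of `D` by a condition `P (a, g)` whose `g`-fibres have `≤ Φ` points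
  have fib : ∀ (P : Fin n × List (Fin 3) → Prop) [DecidablePred P],
      (∀ g ∈ W, ((Finset.univ : Finset (Fin n)).filter (fun a => P (a, g))).card ≤ Φ) →
      (D.filter P).card ≤ 2 ^ k * Φ := by
    intro P _ hP
    have h1 : (D.filter P).card ≤ Φ * ((D.filter P).image Prod.snd).card := by
      refine Finset.card_le_mul_card_image _ _ ?_
      intro g hg
      obtain ⟨p, hp, rfl⟩ := Finset.mem_image.1 hg
      have hpD := (Finset.mem_filter.1 hp).1
      rw [hD, Finset.mem_product] at hpD
      refine le_trans ?_ (hP p.2 hpD.2)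
      refine Finset.card_le_card_of_injOn Prod.fst ?_ ?_
      · intro q hq
        rw [Finset.mem_coe, Finset.mem_filter, Finset.mem_filter] at hq
        rw [Finset.mem_coe, Finset.mem_filter]
        refine ⟨Finset.mem_univ _, ?_⟩
        have := hq.1.2
        rw [← hq.2]
        exact this
      · intro q hq q' hq' hqq'
        rw [Finset.mem_coe, Finset.mem_filter] at hq hq'
        exact Prod.ext hqq' (hq.2.trans hq'.2.symm)
    have h2 : ((D.filter P).image Prod.snd).card ≤ W.card := by
      refine Finset.card_le_card ?_
      intro g hg
      obtain ⟨p, hp, rfl⟩ := Finset.mem_image.1 hg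
      have hpD := (Finset.mem_filter.1 hp).1
      rw [hD, Finset.mem_product] at hpD
      exact hpD.2
    calc (D.filter P).card ≤ Φ * ((D.filter P).image Prod.snd).card := h1
      _ ≤ Φ * W.card := Nat.mul_le_mul_left _ h2
      _ = 2 ^ k * Φ := by rw [hWcard, Nat.mul_comm]
  have memW : ∀ g ∈ W, g.length = k ∧ List.IsChain (· ≠ ·) g ∧ g.head? ≠ some c := by
    intro g hg
    rw [hWdef, Finset.mem_filter, mem_words] at hg
    exact hg
  -- the three families are small
  have hApp_le : ∀ st ∈ Finset.range (k + 1) ×ˢ Finset.range (k + 1), (App st).card ≤ 2 ^ k * Φ := by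
    intro st hst
    rw [Finset.mem_product, Finset.mem_range, Finset.mem_range] at hst
    refine fib _ (fun g hg => ?_)
    obtain ⟨hl, hc, -⟩ := memW g hg
    by_cases hne : st.1 = st.2
    · rw [Finset.filter_false_of_mem (fun a _ h => h.1 hne), Finset.card_empty]
      exact Nat.zero_le _
    · rw [Finset.filter_and, Finset.filter_true_of_mem (fun a _ => hne), Finset.univ_inter]
      rcases Nat.lt_or_gt_of_ne hne with hlt | hgt
      · exact card_pp_fibre_le μ hμ Φ hΦ g hl hc hlt (by omega) id Function.injective_id
      · have e : (Finset.univ : Finset (Fin n)).filter (fun a => (g.take st.1).foldl (fun v b => μ b v) (id a) =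
            (g.take st.2).foldl (fun v b => μ b v) (id a)) = (Finset.univ : Finset (Fin n)).filter
            (fun a => (g.take st.2).foldl (fun v b => μ b v) (id a) = (g.take st.1).foldl (fun v b => μ b v) (id a)) :=
          Finset.filter_congr (fun a _ => eq_comm)
        have := card_pp_fibre_le μ hμ Φ hΦ g hl hc hgt (by omega) id Function.injective_id
        rw [← e] at this
        exact this
  have hAqq_le : ∀ st ∈ Finset.range (k + 1) ×ˢ Finset.range (k + 1), (Aqq st).card ≤ 2 ^ k * Φ := by
    intro st hst
    rw [Finset.mem_product, Finset.mem_range, Finset.mem_range] at hst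
    refine fib _ (fun g hg => ?_)
    obtain ⟨hl, hc, -⟩ := memW g hg
    by_cases hne : st.1 = st.2
    · rw [Finset.filter_false_of_mem (fun a _ h => h.1 hne), Finset.card_empty]
      exact Nat.zero_le _
    · rw [Finset.filter_and, Finset.filter_true_of_mem (fun a _ => hne), Finset.univ_inter]
      rcases Nat.lt_or_gt_of_ne hne with hlt | hgt
      · exact card_pp_fibre_le μ hμ Φ hΦ g hl hc hlt (by omega) (μ c) (μ c).injective
      · have e : (Finset.univ : Finset (Fin n)).filter (fun a => (g.take st.1).foldl (fun v b => μ b v) (μ c a) =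
            (g.take st.2).foldl (fun v b => μ b v) (μ c a)) = (Finset.univ : Finset (Fin n)).filter
            (fun a => (g.take st.2).foldl (fun v b => μ b v) (μ c a) = (g.take st.1).foldl (fun v b => μ b v) (μ c a)) :=
          Finset.filter_congr (fun a _ => eq_comm)
        have := card_pp_fibre_le μ hμ Φ hΦ g hl hc hgt (by omega) (μ c) (μ c).injective
        rw [← e] at this
        exact this
  have hApq_le : ∀ st ∈ Finset.range (k + 1) ×ˢ Finset.range (k + 1), (Apq st).card ≤ 2 ^ k * Φ := by
    intro st hst
    rw [Finset.mem_product, Finset.mem_range, Finset.mem_range] at hst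
    refine fib _ (fun g hg => ?_)
    obtain ⟨hl, hc, hh⟩ := memW g hg
    exact card_pq_fibre_le μ hμ c Φ hΦ g hl hc hh (by omega) (by omega)
  -- cover: an unclean dart has a coincidence at some `s ≠ t`
  have hcover : D.filter (fun p => ¬ clean p) ⊆
      (Finset.range (k + 1) ×ˢ Finset.range (k + 1)).biUnion (fun st => App st ∪ Aqq st ∪ Apq st) := by
    intro p hp
    rw [Finset.mem_filter] at hp
    obtain ⟨hpD, hnc⟩ := hp
    have hnot := mt (hclean p) hnc
    push Not at hnot
    obtain ⟨s, hs, t, ht, h1, h2, h3⟩ := hnot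
    rw [Finset.mem_biUnion]
    -- abbreviations for the four points
    set ps := (p.2.take s).foldl (fun v b => μ b v) p.1
    set qs := (p.2.take s).foldl (fun v b => μ b v) (μ c p.1)
    set pt := (p.2.take t).foldl (fun v b => μ b v) p.1
    set qt := (p.2.take t).foldl (fun v b => μ b v) (μ c p.1)
    have hst : s ≠ t := by
      rintro rfl
      exact h1 rfl rfl
    by_cases e1 : ps = pt
    · exact ⟨(s, t), Finset.mem_product.2 ⟨hs, ht⟩, Finset.mem_union_left _
        (Finset.mem_union_left _ (Finset.mem_filter.2 ⟨hpD, hst, e1⟩))⟩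
    by_cases e2 : qs = qt
    · exact ⟨(s, t), Finset.mem_product.2 ⟨hs, ht⟩, Finset.mem_union_left _
        (Finset.mem_union_right _ (Finset.mem_filter.2 ⟨hpD, hst, e2⟩))⟩
    by_cases e3 : ps = qt
    · exact ⟨(s, t), Finset.mem_product.2 ⟨hs, ht⟩, Finset.mem_union_right _ (Finset.mem_filter.2 ⟨hpD, e3⟩)⟩
    by_cases e4 : qs = pt
    · exact ⟨(t, s), Finset.mem_product.2 ⟨ht, hs⟩, Finset.mem_union_right _ (Finset.mem_filter.2 ⟨hpD, e4.symm⟩)⟩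
    exact absurd (h3 e1 e3 e4) e2
  refine (Finset.card_le_card hcover).trans (Finset.card_biUnion_le.trans ?_)
  have hterm : ∀ st ∈ Finset.range (k + 1) ×ˢ Finset.range (k + 1),
      (App st ∪ Aqq st ∪ Apq st).card ≤ 3 * (2 ^ k * Φ) := by
    intro st hst
    calc (App st ∪ Aqq st ∪ Apq st).card ≤ (App st ∪ Aqq st).card + (Apq st).card := Finset.card_union_le _ _
      _ ≤ (App st).card + (Aqq st).card + (Apq st).card :=
          Nat.add_le_add_right (Finset.card_union_le _ _) _
      _ ≤ 2 ^ k * Φ + 2 ^ k * Φ + 2 ^ k * Φ :=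
          Nat.add_le_add (Nat.add_le_add (hApp_le st hst) (hAqq_le st hst)) (hApq_le st hst)
      _ = 3 * (2 ^ k * Φ) := by ring
  refine (Finset.sum_le_sum hterm).trans ?_
  rw [Finset.sum_const, Finset.card_product, Finset.card_range, smul_eq_mul]
  exact le_of_eq (by ring)

/-- **Registered form** (`stub_poorUniform`, a `--supports` sub-goal of crux `stmt-MatrixMultiplication-10883`, helper for the
open core `stub_poorRigidCore`): the core's POOR hypothesis, verbatim, bounds the fixed points of every nonempty reduced word of
length `≤ L ≤ n^{1/4}` by `(4L²)^(⌊log₂ L⌋+1)·(|R|+1)` (`poor_uniform`). -/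
theorem stub_poorUniform : ∀ (n : ℕ) (μ : Fin 3 → Equiv.Perm (Fin n)), (∀ i, μ i * μ i = 1 ∧ ∀ v, μ i v ≠ v) → ∀ R : Finset (Fin n), (∀ z : List (Fin 3), z ≠ [] → List.IsChain (· ≠ ·) (z ++ z) → (z.length : ℝ) ≤ (n : ℝ) ^ ((1 : ℝ) / 4) → ∀ (m : ℕ) (x : Fin m → Fin n), Function.Injective x → (∀ i, z.foldl (fun v c => μ c v) (x i) = x i) → m ≤ (4 * z.length ^ 2) ^ (Nat.log 2 z.length + 1) * (R.card + 1)) → ∀ L : ℕ, (L : ℝ) ≤ (n : ℝ) ^ ((1 : ℝ) / 4) → ∀ t : List (Fin 3), t ≠ [] → List.IsChain (· ≠ ·) t → t.length ≤ L → ((Finset.univ : Finset (Fin n)).filter (fun x => t.foldl (fun v c => μ c v) x = x)).card ≤ (4 * L ^ 2) ^ (Nat.log 2 L + 1) * (R.card + 1) :=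
  fun _ μ hμ R hpoor L hL => poor_uniform μ hμ R hpoor L hL

/-- **Registered form** (`stub_selfUncleanDarts`, a `--supports` sub-goal of crux `stmt-MatrixMultiplication-10883`, helper for
the open core `stub_poorRigidCore`): self-unclean darts of colour `c` and length `k` number at most `3(k+1)²·2^k·Φ` when every
nonempty reduced word of length `≤ 2k+1` has `≤ Φ` fixed points (`card_selfUnclean_le`); with `stub_poorUniform` at
`L = 2k+1 ≤ n^{1/4}` this is `o(n·2^k)` under POOR, so the restricted supply `sameColourSupply_restricted` (p116043) may be run on
self-clean (and `R`-free) darts at no cost. -/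
theorem stub_selfUncleanDarts : ∀ (n k Φ : ℕ) (μ : Fin 3 → Equiv.Perm (Fin n)) (c : Fin 3) (clean : Fin n × List (Fin 3) → Prop) [DecidablePred clean], (∀ b, μ b * μ b = 1) → (∀ w : List (Fin 3), w ≠ [] → List.IsChain (· ≠ ·) w → w.length ≤ 2 * k + 1 → ((Finset.univ : Finset (Fin n)).filter (fun x => w.foldl (fun v b => μ b v) x = x)).card ≤ Φ) → (∀ p : Fin n × List (Fin 3), (∀ s ∈ Finset.range (k + 1), ∀ t ∈ Finset.range (k + 1), ((p.2.take s).foldl (fun v b => μ b v) p.1 = (p.2.take t).foldl (fun v b => μ b v) p.1 ∧ (p.2.take s).foldl (fun v b => μ b v) (μ c p.1) = (p.2.take t).foldl (fun v b => μ b v) (μ c p.1)) ∨ ((p.2.take s).foldl (fun v b => μ b v) p.1 = (p.2.take t).foldl (fun v b => μ b v) (μ c p.1) ∧ (p.2.take s).foldl (fun v b => μ b v) (μ c p.1) = (p.2.take t).foldl (fun v b => μ b v) p.1) ∨ ((p.2.take s).foldl (fun v b => μ b v) p.1 ≠ (p.2.take t).foldl (fun v b => μ b v) p.1 ∧ (p.2.take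 s).foldl (fun v b => μ b v) p.1 ≠ (p.2.take t).foldl (fun v b => μ b v) (μ c p.1) ∧ (p.2.take s).foldl (fun v b => μ b v) (μ c p.1) ≠ (p.2.take t).foldl (fun v b => μ b v) p.1 ∧ (p.2.take s).foldl (fun v b => μ b v) (μ c p.1) ≠ (p.2.take t).foldl (fun v b => μ b v) (μ c p.1))) → clean p) → (((Finset.univ : Finset (Fin n)) ×ˢ (((Finset.univ : Finset (List.Vector (Fin 3) k)).image (fun v => v.toList)).filter (fun g => List.IsChain (· ≠ ·) g ∧ g.head? ≠ some c))).filter (fun p => ¬ clean p)).card ≤ 3 * (k + 1) ^ 2 * (2 ^ k * Φ) :=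
  fun _ k Φ μ c clean _ hμ hΦ hclean => card_selfUnclean_le μ hμ c k Φ hΦ clean hclean

end Summit.MatrixMultiplication.MatrixMultiplication.Theorems.HyperoctahedralThreshold.SelfCleanDarts
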